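import Summits.QuantumFields.QCD.Theses.PauliWegnerSea
import Summits.QuantumFields.QCD.Theses.WilsonMobilityGap
import Literature.MathematicalPhysics.QuantumFieldTheory.QCDPhaseQuenchedReweighting
import Summits.QuantumFields.QCD.Theorems.GluonicCompletion.Negative.Reweighting
import Summits.QuantumFields.QCD.Theorems.GluonicCompletion.Negative.Threshold
import Summits.QuantumFields.QCD.Theorems.GluonicCompletion.Negative.Flanks
import Summits.QuantumFields.QCD.Theorems.GluonicCompletion.Negative.SignRatio

/-!
# Line `finite-sign-budget-at-the-scheme-volume` for crux `PauliWegnerSea.GluonicCompletion`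
# (stmt-QuantumFields-9152; shared verbatim with `WilsonMobilityGap.GluonicCompletion`, rfl-equal)

Skeleton (crux-plan, planner-cruxplan-stmt-QuantumFields-9152-finite-sign-budget-a-0, 2026-08-15), from
crux idea card `Ideas/finite-sign-budget-at-the-scheme-volume.md` (ideator 1, round 1; triage r1-1/2/3: pass)
with the panel's sharpenings folded in (a.e. non-vanishing of `det` as the first stub; the factor-2 /
covariance device applied ONLY to modulus-inside phase-quenched quantities and only at the scheme's own
side; PQFD-as-filed never reweighted; the `∀ m` hole displayed as `∃ φ` BEFORE `∀ m` in the T-side stub).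

Notation in comments. `H(reg)` = the crux's hypothesis body for ONE regularisation `reg` (leading-log
`HasMassScaling`, two-loop `HasAsymptoticScaling`, and for every `m > 0` clauses (i)–(iv) of
`MobilityGap` + the `PhaseQuenchedFlavourDecay` conclusion), copied VERBATIM into every stub that uses it;
the crux is `∀ N_f ∈ {2,3}, (∃ reg, H(reg)) → QCDOf N_f`. For a scheme `sch` and a step `j`:
`⟨·⟩₊ = qcdPhaseQuenchedExpect (sch.β j) (sch.side j) (sch.mq · j)` (the `|det D|`-reweighted Wilson law
on the scheme's OWN torus of side `2L_j+1`), `W = qcdDetPhase` (the sign of `det D`),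
`R_j(U) = ⟨∏ᵢ Φ_j^{σᵢ}(fᵢ)⟩_F(U)` = Berezin ratio of the smeared product whose HONEST expectation is
`qcdLatticeSchwinger sch j n σ f` (`qcdLatticeSchwinger_eq_qcdTorusExpect`, rfl), `PQ_j = ⟨R_j⟩₊` (the
phase-quenched lattice Schwinger function) and `Cov_j = ⟨W R_j⟩₊ − ⟨W⟩₊⟨R_j⟩₊` (sign–observable covariance).

THE LINE (finite sign budget at the scheme volume). Every OS-data clause of `QCDOf` (`IsQCDAlong`'s
`Tendsto`, hence `IsNontrivial`/`IsNonGaussian`/`T.HasMassGap` of the limit) evaluates the honest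
functional ONLY on the scheme's own tori `sch.side k = 2L_k+1` (QCDOS.lean L393–424), which is exactly
where clause (iv) pins `‖⟨W⟩₊‖ ≥ ½`; `HasLatticeMassGap` alone quantifies `∀ S ≥ L_k`. At that side the
kernel-checked SIGN BUDGET identity `honest − ⟨R⟩₊ = Cov₊(W,R)/⟨W⟩₊` (`norm_qcdTorusExpect_sub_phaseQuenched_le`:
‖honest − PQ‖ ≤ 2‖Cov‖, proved below from (iv) + a.e. `det ≠ 0`) turns the T-side into a statement about
the POSITIVE-weight ensemble plus one decorrelation statement, and confines the all-volume sign problem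
to the lattice-gap stub:
* `detNonvanishing` (support, M–L; RESHAPED by the lead prover-line-stmt-QuantumFields-9152-1 into the
  registered stubs `stub_haarCurveStep` / `stub_detAlongLinkCurve` / `stub_su3CircleWord` /
  `stub_detNonvanishing_of`, see §Stub 1): `det D ≢ 0 ⇒ det D ≠ 0` `μ_W`-a.e. (chart-free: right-invariant
  circle averaging of the product Haar measure + trigonometric dichotomy + `SU(3)` circle generation) — the
  hypothesis of every reweighting identity in the tree; (iv) supplies `det ≢ 0`
  (`exists_det_ne_zero_of_half_le_ratio`).
* `stub_signDecorrelation` (the line's lever, L): along any subsequence on which the phase-quenched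
  Schwinger functions converge, `Cov_{φ k}(W, R) → 0` for off-diagonal smeared products — sign defects
  are LOCAL (crossing modes of `D_W` cored at dislocations, HJL admissibility gap) and LOCALLY RARE
  ((iv) at the diverging physical volume `(a_k(2L_k+1))⁴` forces an `O(1)` TOTAL defect number, so the
  density near any fixed physical region → 0), and `⟨·⟩₊` clusters additively at the scheme volume.
* `stub_pqContinuum` (HARDEST; UV/OS existence in the positive-weight world + the `∀ m` hole): under
  `H(reg)` there is ONE subsequence `φ` such that for EVERY `m > 0` some `(z, shift, T)` has
  `PQ_{φ k} → T.schwinger` with non-trivial non-Gaussian glue, non-decoupled `pseudoRe f g` and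
  `T.HasMassGap Δ_T > 0` — compactness/OS reconstruction/transfer matrix for the `|det|`-weighted Wilson
  theory at the scheme volume, with constants LOCALLY UNIFORM in `m` (H's are pointwise in `m`).
* `stub_signedLatticeGap` (YM-hard; the defect gas on ALL tori): under `H(reg)`, for every `m > 0` the
  honest scheme `reg.scheme m z shift` has `HasLatticeMassGap Δ_L > 0` along the full sequence —
  the only place where the sign must be resolved in log-partition form (`⟨W⟩₊,S ≍ e^{−V_S Δf_k}` for
  `S ≫ L_k`), by a convergent sign-defect polymer expansion on a ratio-mixing `⟨·⟩₊` (fermionic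
  activities: sibling card fibre-flatness-conditional-package; channel bookkeeping: one-minor-per-flavour F4).
* `GluonicCompletion_of : S₁ → S₂ → S₃ → S₄ → PauliWegnerSea.GluonicCompletion` — the kernel-checked
  composition (sorry-free, hypotheses = the four stub statements verbatim; `GluonicCompletion_of_stubs`
  instantiates it with the stubs): `reg' := reg ∘ φ` (definitional reindexing `regSubseq`/`schemeSubseq`),
  `HasMassScaling`/`HasAsymptoticScaling`/(i) pass to the subsequence, the honest `Tendsto` is
  `PQ_{φ k} → T.schwinger` plus `‖honest − PQ‖ ≤ 2‖Cov‖ → 0` (this is where (iv) is USED, at the scheme's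
  own side only), and `Δ := min Δ_T Δ_L` by antitonicity of both gap predicates.

Disproof.lean (cdisprove g2 rev 3; body not mounted in this seat's jail, used through its landed
`Negative/` extracts, all imported here, and its evidence notes) honoured: no `_false_without_<H>` theorem
exists short of `¬QCD` (`Flanks.withoutPerMass_iff_QCD`), so H is threaded VERBATIM into stubs 2–4 and
consumed clause-wise in the composition ((iv) at `norm_qcdTorusExpect_sub_phaseQuenched_le`, (i) and the
scaling clauses in `IsQCDAlong`/`QCDOf` directly); `Threshold.reweighting_not_bookkeeping` (norm-outside
PQFD + (iv) bounds nothing signed) — honoured: the only reweighted quantities are `⟨R⟩₊`, `⟨W R⟩₊` with the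
functional INSIDE `⟨·⟩₊`, and PQFD-as-filed is never reweighted (it enters stubs 3–4 as a hypothesis only);
`Reweighting.qcdTorusExpect_eq_detRatio`/`detRatio_le_two_mul_absMoment` carry `∀ᵐ det ≠ 0` — supplied by
`stub_detNonvanishing`; `Reweighting.qcdLatticeConnectedCorr_eq_zero_of_signedZ_eq_zero` (junk where
`Z_signed = 0`) and `SignRatio.blocks_half_le_pow_all_iff` (all-volume sign coherence would forbid defects)
— honoured: no stub asks sign coherence beyond `S = L_k`; `SignRatio.not_eventually_le_signRatio_of_one_lt`
— the constant stays `½`. Negatives index (`ledger negatives --problem QuantumFields`, 4 QCD entries: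
9494, 9599, 9603, 9665 — MultibosonBridge root ladders, diagonal-mirror RP, adaptive coarse system): no
stub is an instance.
-/

noncomputable section

namespace Summit.QuantumFields.QCD.Cruxes.GluonicCompletion.FiniteSignBudgetAtTheSchemeVolume

open scoped BigOperators Topology ENNReal SchwartzMap
open MeasureTheory Filter
open Literature.MathematicalPhysics.QuantumFieldTheory Literature.MathematicalPhysics.QuantumLattice
  Literature.Probability.LatticeModels Literature.MathematicalPhysics.AQFT

set_option linter.unusedVariables false

/-! ### The four registered stubs -/

/-! #### Stub 1 and its infrastructure (reshape by the lead prover-line-stmt-QuantumFields-9152-1, 2026-08-16)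

`stub_detNonvanishing` (a.e. non-vanishing of the Wilson determinant) is split at the skeleton level into three
definition-free infrastructure stubs and one assembly stub, so that four hands can build it in parallel; its
statement is unchanged and is now the theorem `detNonvanishing` below (composition of the four). The proof
plan is chart-free (no real-analytic-manifold infrastructure): RIGHT-INVARIANT AVERAGING of the product Haar
measure along one-parameter link circles (`stub_haarCurveStep`: Fubini + `μ(Z·t) = μ(Z)` gives
`μ(Z) = μ{g | g·c(θ) ∈ Z ∀θ}` whenever each circle orbit meets `Z` identically or in a Lebesgue-null set), the
one-variable DICHOTOMY "a trigonometric polynomial vanishes identically or on a null set" applied to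
`θ ↦ det D(U·c(θ)·V)` (`stub_detAlongLinkCurve`: the determinant along a one-link circle with trigonometric
entries is a trigonometric polynomial), and GENERATION of `SU(3)` by nine circle letters (`stub_su3CircleWord`:
Givens reduction of the first column + `SU(2)` Euler angles), iterated over all links (`stub_detNonvanishing_of`:
the word set is the whole group, so the averaged set is empty unless `det D ≡ 0`; `μ_W ≪` product Haar). -/

/-- **Stub 1a — right-invariant averaging along a curve (one step; pure measure theory).** For a finite
right-invariant Borel measure `μ` on a topological group `G`, a continuous curve `c : ℝ → G` and a closed set
`Z` such that every right `c`-orbit `θ ↦ g·c(θ)` lies in `Z` identically or meets it in a Lebesgue-null set of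
parameters, `μ(Z) = μ{g | ∀ θ, g·c(θ) ∈ Z}`. Proof: `μ(Z) = ∫₀¹ μ(Z·c(θ)⁻¹) dθ = ∫_G λ{θ ∈ [0,1] | g·c(θ) ∈ Z} dμ(g)`
(right invariance, Tonelli on `G × ℝ` — the set `{(g,θ) | g·c(θ) ∈ Z}` is closed, and `ℝ` is second countable so
the Borel structures match), and the inner measure is `1` on `{g | ∀ θ, g·c(θ) ∈ Z}` and `0` off it. -/
theorem stub_haarCurveStep :
    ∀ (G : Type) [Group G] [TopologicalSpace G] [IsTopologicalGroup G] [MeasurableSpace G] [BorelSpace G]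
      (μ : Measure G) [IsFiniteMeasure μ] [μ.IsMulRightInvariant] (c : ℝ → G), Continuous c →
      ∀ Z : Set G, IsClosed Z →
        (∀ g : G, (∀ θ : ℝ, g * c θ ∈ Z) ∨ volume {θ : ℝ | g * c θ ∈ Z} = 0) →
          μ Z = μ {g : G | ∀ θ : ℝ, g * c θ ∈ Z} := by
  sorry

/-- **Stub 1b — the Wilson determinant along a one-link circle is a trigonometric polynomial.** If the link
curve `c : ℝ → SU(3)` has entries of the form `p(e^{iθ}) e^{-iNθ}` (`p ∈ ℂ[X]`), then so has
`θ ↦ det D(U · δ_e(c(θ)) · V)` for all configurations `U, V` and every edge `e` (`δ_e` = `Pi.mulSingle e`): the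
entries of `D_W` are constants plus constants times entries of `U_{e'} c_{e'}(θ) V_{e'}` and of its inverse
`= conjugate transpose` (tree `wilsonDirac`, `fundamentalRep` = inclusion, `⁻¹ = star` on `specialUnitaryGroup`),
the class `{θ ↦ p(e^{iθ})e^{-iNθ}}` is closed under `+`, `·`, constants and complex conjugation
(`conj(p(e^{iθ})e^{-iNθ}) = q(e^{iθ})e^{-i deg p · θ}`, `q = ∑ₖ conj(aₖ) X^{N + deg p − k}`), and `det` is a
polynomial in the entries (`Matrix.det_apply`). -/
theorem stub_detAlongLinkCurve :
    ∀ (Nf S : ℕ) [NeZero S] (mq : Fin Nf → ℝ) (U V : GaugeConfig 4 S SU3) (e : Edge 4 S) (c : ℝ → SU3),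
      (∀ a b : Fin 3, ∃ (N : ℕ) (p : Polynomial ℂ), ∀ θ : ℝ,
        (c θ : Matrix (Fin 3) (Fin 3) ℂ) a b =
          p.eval (Complex.exp (θ * Complex.I)) * Complex.exp (-(N * θ * Complex.I))) →
      ∃ (N : ℕ) (p : Polynomial ℂ), ∀ θ : ℝ,
        (diracMatrix (U * Pi.mulSingle e (c θ) * V) mq).det =
          p.eval (Complex.exp (θ * Complex.I)) * Complex.exp (-(N * θ * Complex.I)) := by
  sorry

/-- **Stub 1c — `SU(3)` is a nine-letter word in four circles.** Every `A ∈ SU(3)` is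
`[P₁₂(θ₀)R₁₂(θ₁)P₁₂(θ₂)]·[P₀₁(θ₃)R₀₁(θ₄)P₀₁(θ₅)]·[P₁₂(θ₆)R₁₂(θ₇)P₁₂(θ₈)]` with `P_{ij}(θ)` the diagonal phase circle
`diag(e^{iθ}, e^{-iθ})` and `R_{ij}(θ)` the real rotation in the `(i,j)` coordinate plane. Proof: Givens reduction
of the first column `u` of `A` — an `SU(2)` element `M` of the `(1,2)`-block maps `(u₁,u₂) ↦ (r,0)`,
`r = (|u₁|²+|u₂|²)^{1/2}` (`M = r⁻¹[[ū₁, ū₂],[−u₂, u₁]]`, identity if `r = 0`), then `M' = [[ū₀, r],[−r, u₀]]` in the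
`(0,1)`-block maps `(u₀, r) ↦ (1, 0)`; a unitary matrix with first column `e₀` has first row `e₀ᵀ`, so
`M'MA = diag(1, W)`, `W ∈ SU(2)`, and `A = M⁻¹M'⁻¹ diag(1,W) ∈ H₁₂H₀₁H₁₂`; finally every
`[[a, −b̄],[b, ā]] ∈ SU(2)` is `P(α)R(β)P(γ)` with `cos β = |a|`, `sin β = |b|`, `α+γ = arg a`, `γ−α = arg b`
(`Complex.norm_mul_exp_arg_mul_I`). -/
theorem stub_su3CircleWord :
    ∀ A : Matrix (Fin 3) (Fin 3) ℂ, A ∈ Matrix.specialUnitaryGroup (Fin 3) ℂ →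
      ∃ θ : Fin 9 → ℝ,
        A = !![1, 0, 0; 0, Complex.exp (θ 0 * Complex.I), 0; 0, 0, Complex.exp (-(θ 0 * Complex.I))] *
            !![1, 0, 0; 0, (Real.cos (θ 1) : ℂ), -(Real.sin (θ 1) : ℂ); 0, (Real.sin (θ 1) : ℂ), (Real.cos (θ 1) : ℂ)] *
            !![1, 0, 0; 0, Complex.exp (θ 2 * Complex.I), 0; 0, 0, Complex.exp (-(θ 2 * Complex.I))] *
            !![Complex.exp (θ 3 * Complex.I), 0, 0; 0, Complex.exp (-(θ 3 * Complex.I)), 0; 0, 0, 1] *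
            !![(Real.cos (θ 4) : ℂ), -(Real.sin (θ 4) : ℂ), 0; (Real.sin (θ 4) : ℂ), (Real.cos (θ 4) : ℂ), 0; 0, 0, 1] *
            !![Complex.exp (θ 5 * Complex.I), 0, 0; 0, Complex.exp (-(θ 5 * Complex.I)), 0; 0, 0, 1] *
            !![1, 0, 0; 0, Complex.exp (θ 6 * Complex.I), 0; 0, 0, Complex.exp (-(θ 6 * Complex.I))] *
            !![1, 0, 0; 0, (Real.cos (θ 7) : ℂ), -(Real.sin (θ 7) : ℂ); 0, (Real.sin (θ 7) : ℂ), (Real.cos (θ 7) : ℂ)] *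
            !![1, 0, 0; 0, Complex.exp (θ 8 * Complex.I), 0; 0, 0, Complex.exp (-(θ 8 * Complex.I))] := by
  sorry

/-- **Stub 1d — assembly: a.e. non-vanishing of the Wilson determinant from 1a–1c** (held by the lead). With
`G = GaugeConfig 4 S SU(3)` (pointwise group), `μ =` product Haar (finite, right invariant) and the family of closed
sets `Z_H = {U | ∀ h ∈ H, det D(U·h) = 0}` (`H ⊆ G`): 1b (with `V := h`) and the trigonometric dichotomy
(`p ≠ 0 ⇒ {θ | p(e^{iθ}) = 0}` countable) give 1a's hypothesis for every `Z_H` along every one-link circle, and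
`{g | ∀θ, g·c(θ) ∈ Z_H} = Z_{c(ℝ)·H}` stays in the family; iterating over the `9·#edges` letters of 1c (every
`U ∈ G` is the product over edges of `δ_e(U_e)`, each a nine-letter word) gives `μ(Z_{1}) = μ{U | U·G ⊆ Z_{1}} = 0`
unless `det D ≡ 0`, excluded by the witness; finally `μ_W = Z⁻¹ e^{−βS_W} · μ ≪ μ`. -/
theorem stub_detNonvanishing_of :
    (∀ (G : Type) [Group G] [TopologicalSpace G] [IsTopologicalGroup G] [MeasurableSpace G] [BorelSpace G]
    (μ : Measure G) [IsFiniteMeasure μ] [μ.IsMulRightInvariant] (c : ℝ → G), Continuous c →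
    ∀ Z : Set G, IsClosed Z →
    (∀ g : G, (∀ θ : ℝ, g * c θ ∈ Z) ∨ volume {θ : ℝ | g * c θ ∈ Z} = 0) →
    μ Z = μ {g : G | ∀ θ : ℝ, g * c θ ∈ Z}) →
    (∀ (Nf S : ℕ) [NeZero S] (mq : Fin Nf → ℝ) (U V : GaugeConfig 4 S SU3) (e : Edge 4 S) (c : ℝ → SU3),
    (∀ a b : Fin 3, ∃ (N : ℕ) (p : Polynomial ℂ), ∀ θ : ℝ,
    (c θ : Matrix (Fin 3) (Fin 3) ℂ) a b =
    p.eval (Complex.exp (θ * Complex.I)) * Complex.exp (-(N * θ * Complex.I))) →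
    ∃ (N : ℕ) (p : Polynomial ℂ), ∀ θ : ℝ,
    (diracMatrix (U * Pi.mulSingle e (c θ) * V) mq).det =
    p.eval (Complex.exp (θ * Complex.I)) * Complex.exp (-(N * θ * Complex.I))) →
    (∀ A : Matrix (Fin 3) (Fin 3) ℂ, A ∈ Matrix.specialUnitaryGroup (Fin 3) ℂ →
    ∃ θ : Fin 9 → ℝ,
    A = !![1, 0, 0; 0, Complex.exp (θ 0 * Complex.I), 0; 0, 0, Complex.exp (-(θ 0 * Complex.I))] *
    !![1, 0, 0; 0, (Real.cos (θ 1) : ℂ), -(Real.sin (θ 1) : ℂ); 0, (Real.sin (θ 1) : ℂ), (Real.cos (θ 1) : ℂ)] *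
    !![1, 0, 0; 0, Complex.exp (θ 2 * Complex.I), 0; 0, 0, Complex.exp (-(θ 2 * Complex.I))] *
    !![Complex.exp (θ 3 * Complex.I), 0, 0; 0, Complex.exp (-(θ 3 * Complex.I)), 0; 0, 0, 1] *
    !![(Real.cos (θ 4) : ℂ), -(Real.sin (θ 4) : ℂ), 0; (Real.sin (θ 4) : ℂ), (Real.cos (θ 4) : ℂ), 0; 0, 0, 1] *
    !![Complex.exp (θ 5 * Complex.I), 0, 0; 0, Complex.exp (-(θ 5 * Complex.I)), 0; 0, 0, 1] *
    !![1, 0, 0; 0, Complex.exp (θ 6 * Complex.I), 0; 0, 0, Complex.exp (-(θ 6 * Complex.I))] *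
    !![1, 0, 0; 0, (Real.cos (θ 7) : ℂ), -(Real.sin (θ 7) : ℂ); 0, (Real.sin (θ 7) : ℂ), (Real.cos (θ 7) : ℂ)] *
    !![1, 0, 0; 0, Complex.exp (θ 8 * Complex.I), 0; 0, 0, Complex.exp (-(θ 8 * Complex.I))]) →
    ∀ (Nf S : ℕ) [NeZero S] (β : ℝ) (mq : Fin Nf → ℝ),
      (∃ U₀ : GaugeConfig 4 S SU3, (diracMatrix U₀ mq).det ≠ 0) →
        ∀ᵐ U ∂(wilsonMeasure (d := 4) (L := S) (fundamentalRep (Fin 3)) β), (diracMatrix U mq).det ≠ 0 := by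
  sorry

/-- **Stub 1 — `det D` vanishes only on a `μ_W`-null set** (statement unchanged; now the composition of stubs
1a–1d). On every torus of side `S`, for every coupling `β` and bare masses `m_q`: if the `N_f`-flavour Wilson
determinant `det (diracMatrix U m_q)` is not identically zero (one configuration `U₀` with `det ≠ 0`), then it is
nonzero for `μ_W`-almost every gauge field. This is the hypothesis `∀ᵐ U, det ≠ 0` of
`qcdTorusExpect_eq_phaseQuenched`, `Negative.qcdTorusExpect_eq_detRatio`, `Negative.signedCorr_decay_at_own_side`, …;
clause (iv) supplies the witness `U₀` (`exists_det_ne_zero_of_half_le_ratio`). -/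
theorem detNonvanishing :
    ∀ (Nf S : ℕ) [NeZero S] (β : ℝ) (mq : Fin Nf → ℝ),
      (∃ U₀ : GaugeConfig 4 S SU3, (diracMatrix U₀ mq).det ≠ 0) →
        ∀ᵐ U ∂(wilsonMeasure (d := 4) (L := S) (fundamentalRep (Fin 3)) β), (diracMatrix U mq).det ≠ 0 :=
  stub_detNonvanishing_of stub_haarCurveStep stub_detAlongLinkCurve stub_su3CircleWord

/-- **Stub 2 — sign–observable DECORRELATION at the scheme volume (the line's lever; size L, new).**
For `N_f ∈ {2,3}`, a regularisation `reg` with the crux's hypothesis body `H(reg)`, masses `m > 0`,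
renormalisations `(z, shift)` and a subsequence `φ` along which the PHASE-QUENCHED lattice Schwinger
functions of `reg.scheme m z shift` converge to some OS data `T` (exactly the quantifier shape of
`IsQCDAlong`), the phase-quenched covariance between the determinant sign `W` and the Berezin ratio
`R` of every off-diagonal smeared product tends to `0` along `φ`: `⟨W R⟩₊ − ⟨W⟩₊⟨R⟩₊ → 0` at the
scheme's own side `2L_{φ k}+1`. Why plausibly true (and why it might fail): `W = ∏_f (−1)^{n₋(f)}`
(tree `fermionDet_wilsonDirac_eq_sign_mul`) is carried by real modes of `D_W` crossing below `−m_f(k)`,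
which on an AF trajectory are cored at lattice DISLOCATIONS (Hernández–Jansen–Lüscher admissibility
gap; tree named fact `HJLLocality`) — DefectLocality `W = W_near · W_far`; clause (iv) at the scheme
volume, whose physical size `a_k(2L_k+1) → ∞` (`reg.tendsto_L`), keeps the TOTAL expected defect
number `O(1)` (independent-block caricature: `Negative.blocks_signRatio_eq_pow`), so the probability of a
defect within a fixed physical distance of the (essential) supports of the `fᵢ` tends to `0` —
LocalRarity (triage r1-2 (2)); additive clustering of `⟨·⟩₊` at the scheme volume (clause (ii) +
gluonic mixing) decouples `W_far`; the convergence hypothesis bounds the moments of `R`. It fails if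
dislocations do not localise the crossing modes (Aoki-like extended in-gap states at physical masses) or
if the defect density is volume- but not `a`-suppressed (CLS: MohlerSchaefer2020 §4.2 re-read as LOCAL
rarity is the cheapest falsifier). Uses H through (iv), (ii) and `tendsto_L`; H is carried verbatim. -/
theorem stub_signDecorrelation :
    ∀ (Nf : ℕ), Nf = 2 ∨ Nf = 3 → ∀ (reg : QCDRegularisation Nf),
      (reg.HasMassScaling ∧ (reg.scheme 0 0 0).HasAsymptoticScaling ∧
        ∀ m : Fin Nf → ℝ, (∀ f, 0 < m f) →
          ((∀ f : Fin Nf, ∀ᶠ k in atTop, -1 < reg.mcrit k + reg.a k * m f / reg.Zm k) ∧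
            (∃ s δ C : ℝ, 0 < s ∧ s < 1 ∧ 0 < δ ∧ ∀ᶠ k in atTop, ∀ S : ℕ, reg.L k ≤ S → ∀ (f : Fin Nf) (v : Literature.Probability.LatticeModels.Site 4), v ∈ box 4 S → (∫ U : GaugeConfig 4 (2 * S + 1) (Matrix.specialUnitaryGroup (Fin 3) ℂ), ‖(diracMatrix U fun fl => reg.mcrit k + reg.a k * m fl / reg.Zm k).det‖ * (∑ a : Fin 3, ∑ i : Fin 4, ∑ b : Fin 3, ∑ j : Fin 4, ‖(diracMatrix U fun fl => reg.mcrit k + reg.a k * m fl / reg.Zm k)⁻¹ (quarkEquiv (f, (Torus.proj (2 * S + 1) 0, a, i))) (quarkEquiv (f, (Torus.proj (2 * S + 1) (v), b, j)))‖) ^ s ∂(wilsonMeasure (fundamentalRep (Fin 3)) (reg.β k))) / (∫ U : GaugeConfig 4 (2 * S + 1) (Matrix.specialUnitaryGroup (Fin 3) ℂ), ‖(diracMatrix U fun fl => reg.mcrit k + reg.a k * m fl / reg.Zm k).det‖ ∂(wilsonMeasure (fundamentalRep (Fin 3)) (reg.β k))) ≤ C * Real.exp (-(δ * (reg.a k *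 ‖v‖)))) ∧
            (∃ s c₀ C₁ p : ℝ, 0 < s ∧ s < 1 ∧ 0 < c₀ ∧ ∀ᶠ k in atTop, ∀ S : ℕ, reg.L k ≤ S → ∀ (f : Fin Nf) (n : ℕ), n ≤ S → c₀ * Real.exp (-(C₁ * (reg.a k * n) + p * Real.log (n + 1))) ≤ (∫ U : GaugeConfig 4 (2 * S + 1) (Matrix.specialUnitaryGroup (Fin 3) ℂ), ‖(diracMatrix U fun fl => reg.mcrit k + reg.a k * m fl / reg.Zm k).det‖ * (∑ a : Fin 3, ∑ i : Fin 4, ∑ b : Fin 3, ∑ j : Fin 4, ‖(diracMatrix U fun fl => reg.mcrit k + reg.a k * m fl / reg.Zm k)⁻¹ (quarkEquiv (f, (Torus.proj (2 * S + 1) 0, a, i))) (quarkEquiv (f, (Torus.proj (2 * S + 1) (Pi.single 0 (n : ℤ)), b, j)))‖) ^ s ∂(wilsonMeasure (fundamentalRep (Fin 3)) (reg.β k))) / (∫ U : GaugeConfig 4 (2 * S + 1) (Matrix.specialUnitaryGroup (Fin 3) ℂ), ‖(diracMatrix U fun fl => reg.mcrit k + reg.a k * m fl / reg.Zm k).det‖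 ∂(wilsonMeasure (fundamentalRep (Fin 3)) (reg.β k)))) ∧
            (∀ᶠ k in atTop, (1 / 2 : ℝ) ≤ ‖∫ U : GaugeConfig 4 (2 * reg.L k + 1) (Matrix.specialUnitaryGroup (Fin 3) ℂ), (diracMatrix U fun fl => reg.mcrit k + reg.a k * m fl / reg.Zm k).det ∂(wilsonMeasure (fundamentalRep (Fin 3)) (reg.β k))‖ / (∫ U : GaugeConfig 4 (2 * reg.L k + 1) (Matrix.specialUnitaryGroup (Fin 3) ℂ), ‖(diracMatrix U fun fl => reg.mcrit k + reg.a k * m fl / reg.Zm k).det‖ ∂(wilsonMeasure (fundamentalRep (Fin 3)) (reg.β k))))) ∧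
          (∃ δ' : ℝ, 0 < δ' ∧ ∀ (R R' : ℕ) (A : QCDLatticeObservable Nf R) (B : QCDLatticeObservable Nf R'), (∃ (f₀ : Fin Nf) (q : ℤ), q ≠ 0 ∧ ∀ (θ : ℝ) (U : LGConfig 4 (Matrix.specialUnitaryGroup (Fin 3) ℂ)), ExteriorAlgebra.map (LinearMap.pi fun w => (Sum.elim (fun i => if (boxQuarkEquiv.symm i).1 = f₀ then Complex.exp (-((θ : ℂ) * Complex.I)) else 1) (fun i => if (boxQuarkEquiv.symm i).1 = f₀ then Complex.exp ((θ : ℂ) * Complex.I) else 1) (ofLex w)) • LinearMap.proj w) (A.F U) = Complex.exp (((q : ℝ) * θ : ℝ) * Complex.I) • A.F U) → ∃ C' : ℝ, ∀ᶠ k in atTop, ∀ S : ℕ, reg.L k ≤ S → ∀ n : ℕ, n ≤ S → ‖(∫ U : GaugeConfig 4 (2 * S + 1) (Matrix.specialUnitaryGroup (Fin 3) ℂ), (‖(diracMatrix U fun fl => reg.mcrit k + reg.a k * m fl / reg.Zm k).det‖ : ℂ) * (fermiIntegral (A.onTorus (2 * S + 1) 0 U * B.onTorus (2 * S + 1) (Pi.single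 0 (n : ℤ)) U * fermiBoltzmann U fun fl => reg.mcrit k + reg.a k * m fl / reg.Zm k) / fermiIntegral (fermiBoltzmann U fun fl => reg.mcrit k + reg.a k * m fl / reg.Zm k)) ∂(wilsonMeasure (fundamentalRep (Fin 3)) (reg.β k))) / (∫ U : GaugeConfig 4 (2 * S + 1) (Matrix.specialUnitaryGroup (Fin 3) ℂ), (‖(diracMatrix U fun fl => reg.mcrit k + reg.a k * m fl / reg.Zm k).det‖ : ℂ) ∂(wilsonMeasure (fundamentalRep (Fin 3)) (reg.β k)))‖ ≤ C' * Real.exp (-(δ' * (reg.a k * n))))) →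
      ∀ (m : Fin Nf → ℝ), (∀ f, 0 < m f) → ∀ (z shift : QCDField Nf → ℕ → ℝ) (φ : ℕ → ℕ), StrictMono φ →
      (∃ T : OSData (QCDField Nf) 4, ∀ (n : ℕ), n ≠ 0 → ∀ (σ : Fin n → QCDField Nf) (f : Fin n → 𝓢(EuclideanSpace ℝ (Fin 4), ℝ))
          (F : 𝓢((Fin n → EuclideanSpace ℝ (Fin 4)), ℂ)), IsTensorOf F (fun i => ofRealTest (f i)) → IsOffDiagonal F →
          Tendsto (fun k : ℕ => qcdPhaseQuenchedExpect ((reg.scheme m z shift).β (φ k)) ((reg.scheme m z shift).side (φ k)) (fun fl => (reg.scheme m z shift).mq fl (φ k)) (fun U => (fermiIntegral ((List.ofFn fun i => smearedInsertion (reg.scheme m z shift) (φ k) U (σ i) (f i)).prod * fermiBoltzmann U fun fl => (reg.scheme m z shift).mq fl (φ k)) / fermiIntegral (fermiBoltzmann U fun fl => (reg.scheme m z shift).mq fl (φ k))))) atTop (𝓝 (T.schwinger n σ F))) →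
      ∀ (n : ℕ), n ≠ 0 → ∀ (σ : Fin n → QCDField Nf) (f : Fin n → 𝓢(EuclideanSpace ℝ (Fin 4), ℝ))
        (F : 𝓢((Fin n → EuclideanSpace ℝ (Fin 4)), ℂ)), IsTensorOf F (fun i => ofRealTest (f i)) → IsOffDiagonal F →
        Tendsto (fun k : ℕ =>
          (qcdPhaseQuenchedExpect ((reg.scheme m z shift).β (φ k)) ((reg.scheme m z shift).side (φ k)) (fun fl => (reg.scheme m z shift).mq fl (φ k)) (fun U => qcdDetPhase U (fun fl => (reg.scheme m z shift).mq fl (φ k)) * (fermiIntegral ((List.ofFn fun i => smearedInsertion (reg.scheme m z shift) (φ k) U (σ i) (f i)).prod * fermiBoltzmann U fun fl => (reg.scheme m z shift).mq fl (φ k)) / fermiIntegral (fermiBoltzmann U fun fl => (reg.scheme m z shift).mq fl (φ k)))) -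
            qcdPhaseQuenchedExpect ((reg.scheme m z shift).β (φ k)) ((reg.scheme m z shift).side (φ k)) (fun fl => (reg.scheme m z shift).mq fl (φ k)) (fun U => qcdDetPhase U (fun fl => (reg.scheme m z shift).mq fl (φ k))) *
              qcdPhaseQuenchedExpect ((reg.scheme m z shift).β (φ k)) ((reg.scheme m z shift).side (φ k)) (fun fl => (reg.scheme m z shift).mq fl (φ k)) (fun U => (fermiIntegral ((List.ofFn fun i => smearedInsertion (reg.scheme m z shift) (φ k) U (σ i) (f i)).prod * fermiBoltzmann U fun fl => (reg.scheme m z shift).mq fl (φ k)) / fermiIntegral (fermiBoltzmann U fun fl => (reg.scheme m z shift).mq fl (φ k)))))) atTop (𝓝 0) := by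
  sorry

/-- **Stub 3 — the phase-quenched continuum package at the scheme volume (HARDEST; open-problem class).**
For `N_f ∈ {2,3}` and `reg` with `H(reg)` there is ONE strictly increasing `φ : ℕ → ℕ` such that for
EVERY mass tuple `m > 0` there are species renormalisations `(z, shift)` and OS data `T` (E0–E4 as
fields) with: the PHASE-QUENCHED lattice Schwinger functions `PQ_{φ k} = ⟨R⟩₊` of `reg.scheme m z shift`
converge to `T.schwinger` on off-diagonal tensor test functions (the `IsQCDAlong` quantifier shape with
`qcdLatticeSchwinger` replaced by its `|det|`-weighted twin), `T.IsNontrivial glue`,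
`T.IsNonGaussian glue`, every `pseudoRe f g` (`f ≠ g`) non-trivial, and `T.HasMassGap Δ` for some
`Δ > 0`. Why plausibly true / why it might fail: this is UV stability + tightness + OS reconstruction +
Lüscher/Osterwalder–Seiler transfer-matrix gap for the POSITIVE-weight `|det|`-reweighted Wilson theory on
the scheme's own tori (Bałaban-type stability for SU(3) + (ii) clustering of quark lines at physical rate
+ (iii) for non-decoupling + asymptotic scaling for the AF continuum limit) — Yang–Mills-existence grade;
E2 for the phase-quenched family is NOT configuration-wise (|det| of split/odd flavours is not RP) and
must come from `honest − PQ → 0` (stub 2) or be proved in the limit; and the `∀ m` HOLE (FINDINGS F3,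
triage S2): H's constants `s, δ, C, δ', C'` are POINTWISE in `m` while ONE `φ` must serve all `m` — the
prover must re-derive the `⟨·⟩₊` estimates with constants locally uniform on compacts of `(0,∞)^{N_f}`
(free for fractional-moment inputs) and diagonalise (Arzelà–Ascoli in the quark mass); per-`m`
compactness alone cannot close it (`UVStabilityNonUniqueness` pattern transposed to the mass family).
Witnesses `(φ; z, shift, T)` are coupled (e.g. `z ≡ 0` gives vacuum data), so the clauses are one stub. -/
theorem stub_pqContinuum :
    ∀ (Nf : ℕ), Nf = 2 ∨ Nf = 3 → ∀ (reg : QCDRegularisation Nf),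
      (reg.HasMassScaling ∧ (reg.scheme 0 0 0).HasAsymptoticScaling ∧
        ∀ m : Fin Nf → ℝ, (∀ f, 0 < m f) →
          ((∀ f : Fin Nf, ∀ᶠ k in atTop, -1 < reg.mcrit k + reg.a k * m f / reg.Zm k) ∧
            (∃ s δ C : ℝ, 0 < s ∧ s < 1 ∧ 0 < δ ∧ ∀ᶠ k in atTop, ∀ S : ℕ, reg.L k ≤ S → ∀ (f : Fin Nf) (v : Literature.Probability.LatticeModels.Site 4), v ∈ box 4 S → (∫ U : GaugeConfig 4 (2 * S + 1) (Matrix.specialUnitaryGroup (Fin 3) ℂ), ‖(diracMatrix U fun fl => reg.mcrit k + reg.a k * m fl / reg.Zm k).det‖ * (∑ a : Fin 3, ∑ i : Fin 4, ∑ b : Fin 3, ∑ j : Fin 4, ‖(diracMatrix U fun fl => reg.mcrit k + reg.a k * m fl / reg.Zm k)⁻¹ (quarkEquiv (f, (Torus.proj (2 * S + 1) 0, a, i))) (quarkEquiv (f, (Torus.proj (2 * S + 1) (v), b, j)))‖) ^ s ∂(wilsonMeasure (fundamentalRep (Fin 3)) (reg.β k))) / (∫ U : GaugeConfig 4 (2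 * S + 1) (Matrix.specialUnitaryGroup (Fin 3) ℂ), ‖(diracMatrix U fun fl => reg.mcrit k + reg.a k * m fl / reg.Zm k).det‖ ∂(wilsonMeasure (fundamentalRep (Fin 3)) (reg.β k))) ≤ C * Real.exp (-(δ * (reg.a k * ‖v‖)))) ∧
            (∃ s c₀ C₁ p : ℝ, 0 < s ∧ s < 1 ∧ 0 < c₀ ∧ ∀ᶠ k in atTop, ∀ S : ℕ, reg.L k ≤ S → ∀ (f : Fin Nf) (n : ℕ), n ≤ S → c₀ * Real.exp (-(C₁ * (reg.a k * n) + p * Real.log (n + 1))) ≤ (∫ U : GaugeConfig 4 (2 * S + 1) (Matrix.specialUnitaryGroup (Fin 3) ℂ), ‖(diracMatrix U fun fl => reg.mcrit k + reg.a k * m fl / reg.Zm k).det‖ * (∑ a : Fin 3, ∑ i : Fin 4, ∑ b : Fin 3, ∑ j : Fin 4, ‖(diracMatrix U fun fl => reg.mcrit k + reg.a k * m fl / reg.Zm k)⁻¹ (quarkEquiv (f, (Torus.proj (2 * S + 1) 0, a, i))) (quarkEquiv (f, (Torus.proj (2 * S + 1) (Pi.single 0 (n : ℤ)), b, j)))‖)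 ^ s ∂(wilsonMeasure (fundamentalRep (Fin 3)) (reg.β k))) / (∫ U : GaugeConfig 4 (2 * S + 1) (Matrix.specialUnitaryGroup (Fin 3) ℂ), ‖(diracMatrix U fun fl => reg.mcrit k + reg.a k * m fl / reg.Zm k).det‖ ∂(wilsonMeasure (fundamentalRep (Fin 3)) (reg.β k)))) ∧
            (∀ᶠ k in atTop, (1 / 2 : ℝ) ≤ ‖∫ U : GaugeConfig 4 (2 * reg.L k + 1) (Matrix.specialUnitaryGroup (Fin 3) ℂ), (diracMatrix U fun fl => reg.mcrit k + reg.a k * m fl / reg.Zm k).det ∂(wilsonMeasure (fundamentalRep (Fin 3)) (reg.β k))‖ / (∫ U : GaugeConfig 4 (2 * reg.L k + 1) (Matrix.specialUnitaryGroup (Fin 3) ℂ), ‖(diracMatrix U fun fl => reg.mcrit k + reg.a k * m fl / reg.Zm k).det‖ ∂(wilsonMeasure (fundamentalRep (Fin 3)) (reg.β k))))) ∧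
          (∃ δ' : ℝ, 0 < δ' ∧ ∀ (R R' : ℕ) (A : QCDLatticeObservable Nf R) (B : QCDLatticeObservable Nf R'), (∃ (f₀ : Fin Nf) (q : ℤ), q ≠ 0 ∧ ∀ (θ : ℝ) (U : LGConfig 4 (Matrix.specialUnitaryGroup (Fin 3) ℂ)), ExteriorAlgebra.map (LinearMap.pi fun w => (Sum.elim (fun i => if (boxQuarkEquiv.symm i).1 = f₀ then Complex.exp (-((θ : ℂ) * Complex.I)) else 1) (fun i => if (boxQuarkEquiv.symm i).1 = f₀ then Complex.exp ((θ : ℂ) * Complex.I) else 1) (ofLex w)) • LinearMap.proj w) (A.F U) = Complex.exp (((q : ℝ) * θ : ℝ) * Complex.I) • A.F U) → ∃ C' : ℝ, ∀ᶠ k in atTop, ∀ S : ℕ, reg.L k ≤ S → ∀ n : ℕ, n ≤ S → ‖(∫ U : GaugeConfig 4 (2 * S + 1) (Matrix.specialUnitaryGroup (Fin 3) ℂ), (‖(diracMatrix U fun fl => reg.mcrit k + reg.a k * m fl / reg.Zm k).det‖ : ℂ) * (fermiIntegral (A.onTorus (2 * S + 1) 0 U * B.onTorus (2 * S + 1) (Pi.single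 0 (n : ℤ)) U * fermiBoltzmann U fun fl => reg.mcrit k + reg.a k * m fl / reg.Zm k) / fermiIntegral (fermiBoltzmann U fun fl => reg.mcrit k + reg.a k * m fl / reg.Zm k)) ∂(wilsonMeasure (fundamentalRep (Fin 3)) (reg.β k))) / (∫ U : GaugeConfig 4 (2 * S + 1) (Matrix.specialUnitaryGroup (Fin 3) ℂ), (‖(diracMatrix U fun fl => reg.mcrit k + reg.a k * m fl / reg.Zm k).det‖ : ℂ) ∂(wilsonMeasure (fundamentalRep (Fin 3)) (reg.β k)))‖ ≤ C' * Real.exp (-(δ' * (reg.a k * n))))) →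
      ∃ φ : ℕ → ℕ, StrictMono φ ∧ ∀ (m : Fin Nf → ℝ), (∀ f, 0 < m f) →
        ∃ (z shift : QCDField Nf → ℕ → ℝ) (T : OSData (QCDField Nf) 4),
          (∀ (n : ℕ), n ≠ 0 → ∀ (σ : Fin n → QCDField Nf) (f : Fin n → 𝓢(EuclideanSpace ℝ (Fin 4), ℝ))
            (F : 𝓢((Fin n → EuclideanSpace ℝ (Fin 4)), ℂ)), IsTensorOf F (fun i => ofRealTest (f i)) → IsOffDiagonal F →
            Tendsto (fun k : ℕ => qcdPhaseQuenchedExpect ((reg.scheme m z shift).β (φ k)) ((reg.scheme m z shift).side (φ k)) (fun fl => (reg.scheme m z shift).mq fl (φ k)) (fun U => (fermiIntegral ((List.ofFn fun i => smearedInsertion (reg.scheme m z shift) (φ k) U (σ i) (f i)).prod * fermiBoltzmann U fun fl => (reg.scheme m z shift).mq fl (φ k)) / fermiIntegral (fermiBoltzmann U fun fl => (reg.scheme m z shift).mq fl (φ k))))) atTop (𝓝 (T.schwinger n σ F))) ∧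
          T.IsNontrivial QCDField.glue ∧ T.IsNonGaussian QCDField.glue ∧
          (∀ f g : Fin Nf, f ≠ g → T.IsNontrivial (QCDField.pseudoRe f g)) ∧
          ∃ Δ > 0, T.HasMassGap Δ := by
  sorry

/-- **Stub 4 — the SIGNED lattice gap on all tori (the defect gas; Yang–Mills-hard, open).** For
`N_f ∈ {2,3}`, `reg` with `H(reg)` and every `m > 0` there is `Δ > 0` with
`(reg.scheme m z shift).HasLatticeMassGap Δ` (for all `z, shift` — the predicate does not see them):
connected Euclidean-time correlations of ALL gauge-invariant local lattice QCD observables in the HONEST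
signed theory decay at rate `Δ a_k n` on every torus `S ≥ L_k`, eventually in `k` along the full
sequence. Why plausibly true / why it might fail: this is the one clause where the sign must be resolved
in log-partition form — for `S ≫ L_k`, `⟨W⟩₊,S ≍ exp(−V_S Δf_k) → 0` (`Negative.SignRatio` block model),
so no reweighting helps (`Negative.chargedLatticeGap_of_allVolume_signCoherence` isolates exactly the
missing input); the intended proof is a convergent SIGN-DEFECT polymer expansion relative to a
ratio-mixing phase-quenched reference (Kotecký–Preiss / BCO), whose diluteness at ALL `S ≥ L_k` at the
same `k` follows from the INTENSIVE defect density forced to `0` by (iv) at the diverging scheme volume,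
whose fermionic activities must be conditional / twist-uniform (sibling card
fibre-flatness-conditional-package: K1/K3 of PauliWegnerSea, not the global clause (ii) — FINDINGS F6) and
Jacobi-whole per flavour (one-minor-per-flavour F4: same-flavour hairpin splits are not `⟨·⟩₊`-integrable
for split masses), and whose gluonic input is volume-uniform clustering of `⟨·⟩₊` at weak coupling — the
Yang–Mills mass-gap core with dynamical quarks (no such theorem exists: JaffeWitten2000 §5,
Balaban1988Convergent gives stability without clustering). `HasAsymptoticScaling` is load-bearing (a
runaway `β_k` satisfies the per-mass clauses with nearly massless glue in `a_k`-units); for `N_f = 2`,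
`m_u = m_d` the charged slice is sign-free on all tori (`Negative.chargedLatticeGap_two_degenerate`). -/
theorem stub_signedLatticeGap :
    ∀ (Nf : ℕ), Nf = 2 ∨ Nf = 3 → ∀ (reg : QCDRegularisation Nf),
      (reg.HasMassScaling ∧ (reg.scheme 0 0 0).HasAsymptoticScaling ∧
        ∀ m : Fin Nf → ℝ, (∀ f, 0 < m f) →
          ((∀ f : Fin Nf, ∀ᶠ k in atTop, -1 < reg.mcrit k + reg.a k * m f / reg.Zm k) ∧
            (∃ s δ C : ℝ, 0 < s ∧ s < 1 ∧ 0 < δ ∧ ∀ᶠ k in atTop, ∀ S : ℕ, reg.L k ≤ S → ∀ (f : Fin Nf) (v : Literature.Probability.LatticeModels.Site 4), v ∈ box 4 S → (∫ U : GaugeConfig 4 (2 * S + 1) (Matrix.specialUnitaryGroup (Fin 3) ℂ), ‖(diracMatrix U fun fl => reg.mcrit k + reg.a k * m fl / reg.Zm k).det‖ * (∑ a : Fin 3, ∑ i : Fin 4, ∑ b : Fin 3, ∑ j : Fin 4, ‖(diracMatrix U fun fl => reg.mcrit k + reg.a k * m fl / reg.Zm k)⁻¹ (quarkEquiv (f,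 (Torus.proj (2 * S + 1) 0, a, i))) (quarkEquiv (f, (Torus.proj (2 * S + 1) (v), b, j)))‖) ^ s ∂(wilsonMeasure (fundamentalRep (Fin 3)) (reg.β k))) / (∫ U : GaugeConfig 4 (2 * S + 1) (Matrix.specialUnitaryGroup (Fin 3) ℂ), ‖(diracMatrix U fun fl => reg.mcrit k + reg.a k * m fl / reg.Zm k).det‖ ∂(wilsonMeasure (fundamentalRep (Fin 3)) (reg.β k))) ≤ C * Real.exp (-(δ * (reg.a k * ‖v‖)))) ∧
            (∃ s c₀ C₁ p : ℝ, 0 < s ∧ s < 1 ∧ 0 < c₀ ∧ ∀ᶠ k in atTop, ∀ S : ℕ, reg.L k ≤ S → ∀ (f : Fin Nf) (n : ℕ), n ≤ S → c₀ * Real.exp (-(C₁ * (reg.a k * n) + p * Real.log (n + 1))) ≤ (∫ U : GaugeConfig 4 (2 * S + 1) (Matrix.specialUnitaryGroup (Fin 3) ℂ), ‖(diracMatrix U fun fl => reg.mcrit k + reg.a k * m fl / reg.Zm k).det‖ * (∑ a : Fin 3, ∑ i : Fin 4, ∑ b : Fin 3, ∑ j : Fin 4, ‖(diracMatrix U fun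 fl => reg.mcrit k + reg.a k * m fl / reg.Zm k)⁻¹ (quarkEquiv (f, (Torus.proj (2 * S + 1) 0, a, i))) (quarkEquiv (f, (Torus.proj (2 * S + 1) (Pi.single 0 (n : ℤ)), b, j)))‖) ^ s ∂(wilsonMeasure (fundamentalRep (Fin 3)) (reg.β k))) / (∫ U : GaugeConfig 4 (2 * S + 1) (Matrix.specialUnitaryGroup (Fin 3) ℂ), ‖(diracMatrix U fun fl => reg.mcrit k + reg.a k * m fl / reg.Zm k).det‖ ∂(wilsonMeasure (fundamentalRep (Fin 3)) (reg.β k)))) ∧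
            (∀ᶠ k in atTop, (1 / 2 : ℝ) ≤ ‖∫ U : GaugeConfig 4 (2 * reg.L k + 1) (Matrix.specialUnitaryGroup (Fin 3) ℂ), (diracMatrix U fun fl => reg.mcrit k + reg.a k * m fl / reg.Zm k).det ∂(wilsonMeasure (fundamentalRep (Fin 3)) (reg.β k))‖ / (∫ U : GaugeConfig 4 (2 * reg.L k + 1) (Matrix.specialUnitaryGroup (Fin 3) ℂ), ‖(diracMatrix U fun fl => reg.mcrit k + reg.a k * m fl / reg.Zm k).det‖ ∂(wilsonMeasure (fundamentalRep (Fin 3)) (reg.β k))))) ∧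
          (∃ δ' : ℝ, 0 < δ' ∧ ∀ (R R' : ℕ) (A : QCDLatticeObservable Nf R) (B : QCDLatticeObservable Nf R'), (∃ (f₀ : Fin Nf) (q : ℤ), q ≠ 0 ∧ ∀ (θ : ℝ) (U : LGConfig 4 (Matrix.specialUnitaryGroup (Fin 3) ℂ)), ExteriorAlgebra.map (LinearMap.pi fun w => (Sum.elim (fun i => if (boxQuarkEquiv.symm i).1 = f₀ then Complex.exp (-((θ : ℂ) * Complex.I)) else 1) (fun i => if (boxQuarkEquiv.symm i).1 = f₀ then Complex.exp ((θ : ℂ) * Complex.I) else 1) (ofLex w)) • LinearMap.proj w) (A.F U) = Complex.exp (((q : ℝ) * θ : ℝ) * Complex.I) • A.F U) → ∃ C' : ℝ, ∀ᶠ k in atTop, ∀ S : ℕ, reg.L k ≤ S → ∀ n : ℕ, n ≤ S → ‖(∫ U : GaugeConfig 4 (2 * S + 1) (Matrix.specialUnitaryGroup (Fin 3) ℂ), (‖(diracMatrix U fun fl => reg.mcrit k + reg.a k * m fl / reg.Zm k).det‖ : ℂ) * (fermiIntegral (A.onTorus (2 * S + 1) 0 U * B.onTorus (2 * S + 1) (Pi.single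 0 (n : ℤ)) U * fermiBoltzmann U fun fl => reg.mcrit k + reg.a k * m fl / reg.Zm k) / fermiIntegral (fermiBoltzmann U fun fl => reg.mcrit k + reg.a k * m fl / reg.Zm k)) ∂(wilsonMeasure (fundamentalRep (Fin 3)) (reg.β k))) / (∫ U : GaugeConfig 4 (2 * S + 1) (Matrix.specialUnitaryGroup (Fin 3) ℂ), (‖(diracMatrix U fun fl => reg.mcrit k + reg.a k * m fl / reg.Zm k).det‖ : ℂ) ∂(wilsonMeasure (fundamentalRep (Fin 3)) (reg.β k)))‖ ≤ C' * Real.exp (-(δ' * (reg.a k * n))))) →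
      ∀ (m : Fin Nf → ℝ), (∀ f, 0 < m f) →
        ∃ Δ > 0, ∀ (z shift : QCDField Nf → ℕ → ℝ), (reg.scheme m z shift).HasLatticeMassGap Δ := by
  sorry

/-! ### Composition helpers (sorry-free): subsequences, antitonicity, and the sign budget at one volume -/

section Helpers

variable {Nf : ℕ}

/-- The subsequence `sch ∘ φ` of a scheme (all data precomposed with a strictly increasing `φ`). -/
def schemeSubseq (sch : QCDScheme Nf) (φ : ℕ → ℕ) (hφ : StrictMono φ) : QCDScheme Nf where
  a := fun k => sch.a (φ k)
  a_pos := fun k => sch.a_pos (φ k)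
  tendsto_a := sch.tendsto_a.comp hφ.tendsto_atTop
  β := fun k => sch.β (φ k)
  L := fun k => sch.L (φ k)
  tendsto_L := sch.tendsto_L.comp hφ.tendsto_atTop
  mq := fun f k => sch.mq f (φ k)
  z := fun s k => sch.z s (φ k)
  shift := fun s k => sch.shift s (φ k)

/-- The subsequence `reg ∘ φ` of a regularisation (`m_crit`, `Z_m` precomposed too; no offset). -/
def regSubseq (reg : QCDRegularisation Nf) (φ : ℕ → ℕ) (hφ : StrictMono φ) : QCDRegularisation Nf where
  a := fun k => reg.a (φ k)
  a_pos := fun k => reg.a_pos (φ k)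
  tendsto_a := reg.tendsto_a.comp hφ.tendsto_atTop
  β := fun k => reg.β (φ k)
  L := fun k => reg.L (φ k)
  tendsto_L := reg.tendsto_L.comp hφ.tendsto_atTop
  mcrit := fun k => reg.mcrit (φ k)
  Zm := fun k => reg.Zm (φ k)
  Zm_pos := fun k => reg.Zm_pos (φ k)

/-- The scheme of the subsequence regularisation is the subsequence of the scheme (DEFINITIONAL: the
bare-mass trajectory `m_crit(φ k) + a_{φ k} m_f / Z_m(φ k)` reindexes on the nose). -/
theorem regSubseq_scheme (reg : QCDRegularisation Nf) (φ : ℕ → ℕ) (hφ : StrictMono φ)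
    (m : Fin Nf → ℝ) (z shift : QCDField Nf → ℕ → ℝ) :
    (regSubseq reg φ hφ).scheme m (fun s k => z s (φ k)) (fun s k => shift s (φ k)) =
      schemeSubseq (reg.scheme m z shift) φ hφ := rfl

/-- Lattice Schwinger functions reindex along subsequences (definitional). -/
theorem qcdLatticeSchwinger_subseq (sch : QCDScheme Nf) (φ : ℕ → ℕ) (hφ : StrictMono φ)
    (k n : ℕ) (σ : Fin n → QCDField Nf) (f : Fin n → 𝓢(EuclideanSpace ℝ (Fin 4), ℝ)) :
    qcdLatticeSchwinger (schemeSubseq sch φ hφ) k n σ f = qcdLatticeSchwinger sch (φ k) n σ f := rfl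

/-- The lattice Schwinger function IS the honest torus expectation `qcdTorusExpect` of the smeared
product, at the scheme's own side `sch.side k = 2L_k+1` (definitional) — the quantifier-geometry fact the
line rests on: no OS-data clause of `QCDOf` sees any other torus. -/
theorem qcdLatticeSchwinger_eq_qcdTorusExpect (sch : QCDScheme Nf) (k n : ℕ) (σ : Fin n → QCDField Nf)
    (f : Fin n → 𝓢(EuclideanSpace ℝ (Fin 4), ℝ)) :
    qcdLatticeSchwinger sch k n σ f =
      qcdTorusExpect (sch.β k) (sch.side k) (fun fl => sch.mq fl k)
        (fun U => (List.ofFn fun i => smearedInsertion sch k U (σ i) (f i)).prod) := rfl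

/-- `HasLatticeMassGap` passes to subsequences. -/
theorem hasLatticeMassGap_subseq {sch : QCDScheme Nf} {Δ : ℝ} (h : sch.HasLatticeMassGap Δ)
    (φ : ℕ → ℕ) (hφ : StrictMono φ) : (schemeSubseq sch φ hφ).HasLatticeMassGap Δ := by
  intro R R' A B
  obtain ⟨C, hC⟩ := h R R' A B
  exact ⟨C, hφ.tendsto_atTop.eventually hC⟩

/-- `HasAsymptoticScaling` passes to subsequences. -/
theorem hasAsymptoticScaling_subseq {sch : QCDScheme Nf} (h : sch.HasAsymptoticScaling)
    (φ : ℕ → ℕ) (hφ : StrictMono φ) : (schemeSubseq sch φ hφ).HasAsymptoticScaling := by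
  obtain ⟨Λ, hΛ, h⟩ := h
  exact ⟨Λ, hΛ, h.comp hφ.tendsto_atTop⟩

/-- `HasMassScaling` passes to subsequences. -/
theorem hasMassScaling_subseq {reg : QCDRegularisation Nf} (h : reg.HasMassScaling)
    (φ : ℕ → ℕ) (hφ : StrictMono φ) : (regSubseq reg φ hφ).HasMassScaling := by
  obtain ⟨c, hc, h⟩ := h
  exact ⟨c, hc, h.comp hφ.tendsto_atTop⟩

/-- The lattice gap predicate is antitone in `Δ` (`a_k > 0`, `n ≥ 0`). -/
theorem hasLatticeMassGap_anti {sch : QCDScheme Nf} {Δ Δ' : ℝ} (h : sch.HasLatticeMassGap Δ)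
    (hle : Δ' ≤ Δ) : sch.HasLatticeMassGap Δ' := by
  intro R R' A B
  obtain ⟨C, hC⟩ := h R R' A B
  refine ⟨max C 0, ?_⟩
  filter_upwards [hC] with k hk S hS n hn
  refine (hk S hS n hn).trans ?_
  have ha : 0 ≤ sch.a k * n := mul_nonneg (sch.a_pos k).le (Nat.cast_nonneg n)
  calc C * Real.exp (-(Δ * (sch.a k * n)))
      ≤ max C 0 * Real.exp (-(Δ * (sch.a k * n))) :=
        mul_le_mul_of_nonneg_right (le_max_left _ _) (Real.exp_pos _).le
    _ ≤ max C 0 * Real.exp (-(Δ' * (sch.a k * n))) :=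
        mul_le_mul_of_nonneg_left (Real.exp_le_exp.2 (by nlinarith)) (le_max_right _ _)

/-- The OS mass-gap predicate is antitone in `Δ` (`t ≥ 0`). -/
theorem hasMassGap_anti {ι : Type} {d : ℕ} [NeZero d] {T : OSData ι d} {Δ Δ' : ℝ}
    (h : T.HasMassGap Δ) (hle : Δ' ≤ Δ) : T.HasMassGap Δ' := by
  intro n m k k' F G hF hG
  obtain ⟨C, hC⟩ := h n m k k' F G hF hG
  refine ⟨max C 0, fun t ht H hH => (hC t ht H hH).trans ?_⟩
  calc C * Real.exp (-Δ * t)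
      ≤ max C 0 * Real.exp (-Δ * t) :=
        mul_le_mul_of_nonneg_right (le_max_left _ _) (Real.exp_pos _).le
    _ ≤ max C 0 * Real.exp (-Δ' * t) :=
        mul_le_mul_of_nonneg_left (Real.exp_le_exp.2 (by nlinarith)) (le_max_right _ _)

variable {S : ℕ} [NeZero S]

/-- Clause (iv) at one volume forces `det D ≢ 0` there (else `∫ |det| = 0` and the ratio is the junk
`0 < ½`; `Negative.integral_norm_det_pos_of_half_le_ratio`) — the witness `stub_detNonvanishing` wants. -/
theorem exists_det_ne_zero_of_half_le_ratio (β : ℝ) (mq : Fin Nf → ℝ)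
    (h : (1 / 2 : ℝ) ≤ ‖∫ U, (diracMatrix U mq).det ∂(wilsonMeasure (d := 4) (L := S) (fundamentalRep (Fin 3)) β)‖ /
      ∫ U, ‖(diracMatrix U mq).det‖ ∂(wilsonMeasure (d := 4) (L := S) (fundamentalRep (Fin 3)) β)) :
    ∃ U₀ : GaugeConfig 4 S SU3, (diracMatrix U₀ mq).det ≠ 0 := by
  by_contra hall
  simp only [not_exists, not_not] at hall
  have hZ := Summit.QuantumFields.QCD.Theorems.GluonicCompletion.Negative.integral_norm_det_pos_of_half_le_ratio
    (S := S) β mq h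
  simp [hall] at hZ

/-- **THE SIGN BUDGET AT ONE VOLUME (kernel-checked; this is where clause (iv) is used).** On a torus of
side `S`, if `‖∫ det D dμ_W‖ ≥ ½ ∫ |det D| dμ_W` (clause (iv), available at the scheme's OWN side only)
and `det D ≠ 0` a.e., then for every Grassmann-valued gauge functional `X` with Berezin ratio
`R = ⟨X⟩_F`: `honest − phase-quenched = Cov₊(W, R)/⟨W⟩₊`, hence
`‖qcdTorusExpect β S m X − ⟨R⟩₊‖ ≤ 2 ‖⟨W R⟩₊ − ⟨W⟩₊⟨R⟩₊‖`. The denominator is `O(1)`; no exponentially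
small partition-function ratio appears; what remains is ADDITIVE decorrelation (`stub_signDecorrelation`).
(Tree `qcdTorusExpect_eq_phaseQuenched` + `norm_qcdPhaseQuenchedExpect_qcdDetPhase`.) -/
theorem norm_qcdTorusExpect_sub_phaseQuenched_le (β : ℝ) (mq : Fin Nf → ℝ)
    (X : GaugeConfig 4 S SU3 → FermiAlg Nf S)
    (hIV : (1 / 2 : ℝ) ≤ ‖∫ U, (diracMatrix U mq).det ∂(wilsonMeasure (d := 4) (L := S) (fundamentalRep (Fin 3)) β)‖ /
      ∫ U, ‖(diracMatrix U mq).det‖ ∂(wilsonMeasure (d := 4) (L := S) (fundamentalRep (Fin 3)) β))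
    (hae : ∀ᵐ U ∂(wilsonMeasure (d := 4) (L := S) (fundamentalRep (Fin 3)) β), (diracMatrix U mq).det ≠ 0) :
    ‖qcdTorusExpect β S mq X -
        qcdPhaseQuenchedExpect β S mq (fun U =>
          fermiIntegral (X U * fermiBoltzmann U mq) / fermiIntegral (fermiBoltzmann U mq))‖ ≤
      2 * ‖qcdPhaseQuenchedExpect β S mq (fun U => qcdDetPhase U mq *
              (fermiIntegral (X U * fermiBoltzmann U mq) / fermiIntegral (fermiBoltzmann U mq))) -
            qcdPhaseQuenchedExpect β S mq (fun U => qcdDetPhase U mq) *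
              qcdPhaseQuenchedExpect β S mq (fun U =>
                fermiIntegral (X U * fermiBoltzmann U mq) / fermiIntegral (fermiBoltzmann U mq))‖ := by
  rw [qcdTorusExpect_eq_phaseQuenched β mq X hae]
  set A := qcdPhaseQuenchedExpect β S mq (fun U => qcdDetPhase U mq *
    (fermiIntegral (X U * fermiBoltzmann U mq) / fermiIntegral (fermiBoltzmann U mq))) with hA
  set w := qcdPhaseQuenchedExpect β S mq (fun U => qcdDetPhase U mq) with hw
  set r := qcdPhaseQuenchedExpect β S mq (fun U =>
    fermiIntegral (X U * fermiBoltzmann U mq) / fermiIntegral (fermiBoltzmann U mq)) with hr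
  have hwn : (1 / 2 : ℝ) ≤ ‖w‖ := by rw [hw, norm_qcdPhaseQuenchedExpect_qcdDetPhase]; exact hIV
  have hw0 : w ≠ 0 := fun h0 => by rw [h0, norm_zero] at hwn; norm_num at hwn
  have key : (A - w * r) / w = A / w - r := by rw [sub_div, mul_div_cancel_left₀ r hw0]
  rw [← key, norm_div, div_le_iff₀ (norm_pos_iff.2 hw0)]
  nlinarith [norm_nonneg (A - w * r), hwn]

end Helpers

/-! ### The composition -/

/-- **`GluonicCompletion` from the four stubs (kernel-checked, sorry-free; hypotheses = the stub
statements verbatim).** Given `N_f ∈ {2,3}` and `reg` with `H(reg)`: take `φ` from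
`stub_pqContinuum`; the witness regularisation is `reg' := reg ∘ φ` (`regSubseq`; its scheme at masses
`m` with `(z ∘ φ, shift ∘ φ)` is DEFINITIONALLY the subsequence of `reg.scheme m z shift`), which keeps
`HasMassScaling`; for each `m > 0` take `(z, shift, T, Δ_T)` from `stub_pqContinuum` and `Δ_L` from
`stub_signedLatticeGap`; `IsQCDAlong`: asymptotic scaling and clause (i) reindex along `φ`, and the honest
`n`-point functions converge because `PQ_{φ k} → T.schwinger` (stub 3) and
`‖honest − PQ‖ ≤ 2‖Cov‖ → 0` — the sign budget `norm_qcdTorusExpect_sub_phaseQuenched_le` fed by clause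
(iv) (transported along `φ`), by `stub_detNonvanishing` (witness from (iv)) and by
`stub_signDecorrelation`; the soft clauses are `T`'s; `Δ := min Δ_T Δ_L` by antitonicity. -/
theorem GluonicCompletion_of
    (h₁ : ∀ (Nf S : ℕ) [NeZero S] (β : ℝ) (mq : Fin Nf → ℝ),
        (∃ U₀ : GaugeConfig 4 S SU3, (diracMatrix U₀ mq).det ≠ 0) →
          ∀ᵐ U ∂(wilsonMeasure (d := 4) (L := S) (fundamentalRep (Fin 3)) β), (diracMatrix U mq).det ≠ 0)
    (h₂ : ∀ (Nf : ℕ), Nf = 2 ∨ Nf = 3 → ∀ (reg : QCDRegularisation Nf),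
        (reg.HasMassScaling ∧ (reg.scheme 0 0 0).HasAsymptoticScaling ∧
          ∀ m : Fin Nf → ℝ, (∀ f, 0 < m f) →
            ((∀ f : Fin Nf, ∀ᶠ k in atTop, -1 < reg.mcrit k + reg.a k * m f / reg.Zm k) ∧
              (∃ s δ C : ℝ, 0 < s ∧ s < 1 ∧ 0 < δ ∧ ∀ᶠ k in atTop, ∀ S : ℕ, reg.L k ≤ S → ∀ (f : Fin Nf) (v : Literature.Probability.LatticeModels.Site 4), v ∈ box 4 S → (∫ U : GaugeConfig 4 (2 * S + 1) (Matrix.specialUnitaryGroup (Fin 3) ℂ), ‖(diracMatrix U fun fl => reg.mcrit k + reg.a k * m fl / reg.Zm k).det‖ * (∑ a : Fin 3, ∑ i : Fin 4, ∑ b : Fin 3, ∑ j : Fin 4, ‖(diracMatrix U fun fl => reg.mcrit k + reg.a k * m fl / reg.Zm k)⁻¹ (quarkEquiv (f, (Torus.proj (2 * S + 1) 0, a, i))) (quarkEquiv (f, (Torus.proj (2 * S + 1) (v), b, j)))‖) ^ s ∂(wilsonMeasure (fundamentalRep (Fin 3)) (reg.β k))) / (∫ U : GaugeConfig 4 (2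 * S + 1) (Matrix.specialUnitaryGroup (Fin 3) ℂ), ‖(diracMatrix U fun fl => reg.mcrit k + reg.a k * m fl / reg.Zm k).det‖ ∂(wilsonMeasure (fundamentalRep (Fin 3)) (reg.β k))) ≤ C * Real.exp (-(δ * (reg.a k * ‖v‖)))) ∧
              (∃ s c₀ C₁ p : ℝ, 0 < s ∧ s < 1 ∧ 0 < c₀ ∧ ∀ᶠ k in atTop, ∀ S : ℕ, reg.L k ≤ S → ∀ (f : Fin Nf) (n : ℕ), n ≤ S → c₀ * Real.exp (-(C₁ * (reg.a k * n) + p * Real.log (n + 1))) ≤ (∫ U : GaugeConfig 4 (2 * S + 1) (Matrix.specialUnitaryGroup (Fin 3) ℂ), ‖(diracMatrix U fun fl => reg.mcrit k + reg.a k * m fl / reg.Zm k).det‖ * (∑ a : Fin 3, ∑ i : Fin 4, ∑ b : Fin 3, ∑ j : Fin 4, ‖(diracMatrix U fun fl => reg.mcrit k + reg.a k * m fl / reg.Zm k)⁻¹ (quarkEquiv (f, (Torus.proj (2 * S + 1) 0, a, i))) (quarkEquiv (f, (Torus.proj (2 * S + 1) (Pi.single 0 (n : ℤ)), b, j)))‖)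 ^ s ∂(wilsonMeasure (fundamentalRep (Fin 3)) (reg.β k))) / (∫ U : GaugeConfig 4 (2 * S + 1) (Matrix.specialUnitaryGroup (Fin 3) ℂ), ‖(diracMatrix U fun fl => reg.mcrit k + reg.a k * m fl / reg.Zm k).det‖ ∂(wilsonMeasure (fundamentalRep (Fin 3)) (reg.β k)))) ∧
              (∀ᶠ k in atTop, (1 / 2 : ℝ) ≤ ‖∫ U : GaugeConfig 4 (2 * reg.L k + 1) (Matrix.specialUnitaryGroup (Fin 3) ℂ), (diracMatrix U fun fl => reg.mcrit k + reg.a k * m fl / reg.Zm k).det ∂(wilsonMeasure (fundamentalRep (Fin 3)) (reg.β k))‖ / (∫ U : GaugeConfig 4 (2 * reg.L k + 1) (Matrix.specialUnitaryGroup (Fin 3) ℂ), ‖(diracMatrix U fun fl => reg.mcrit k + reg.a k * m fl / reg.Zm k).det‖ ∂(wilsonMeasure (fundamentalRep (Fin 3)) (reg.β k))))) ∧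
            (∃ δ' : ℝ, 0 < δ' ∧ ∀ (R R' : ℕ) (A : QCDLatticeObservable Nf R) (B : QCDLatticeObservable Nf R'), (∃ (f₀ : Fin Nf) (q : ℤ), q ≠ 0 ∧ ∀ (θ : ℝ) (U : LGConfig 4 (Matrix.specialUnitaryGroup (Fin 3) ℂ)), ExteriorAlgebra.map (LinearMap.pi fun w => (Sum.elim (fun i => if (boxQuarkEquiv.symm i).1 = f₀ then Complex.exp (-((θ : ℂ) * Complex.I)) else 1) (fun i => if (boxQuarkEquiv.symm i).1 = f₀ then Complex.exp ((θ : ℂ) * Complex.I) else 1) (ofLex w)) • LinearMap.proj w) (A.F U) = Complex.exp (((q : ℝ) * θ : ℝ) * Complex.I) • A.F U) → ∃ C' : ℝ, ∀ᶠ k in atTop, ∀ S : ℕ, reg.L k ≤ S → ∀ n : ℕ, n ≤ S → ‖(∫ U : GaugeConfig 4 (2 * S + 1) (Matrix.specialUnitaryGroup (Fin 3) ℂ), (‖(diracMatrix U fun fl => reg.mcrit k + reg.a k * m fl / reg.Zm k).det‖ : ℂ) * (fermiIntegral (A.onTorus (2 * S + 1) 0 U * B.onTorus (2 * S + 1) (Pi.single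 0 (n : ℤ)) U * fermiBoltzmann U fun fl => reg.mcrit k + reg.a k * m fl / reg.Zm k) / fermiIntegral (fermiBoltzmann U fun fl => reg.mcrit k + reg.a k * m fl / reg.Zm k)) ∂(wilsonMeasure (fundamentalRep (Fin 3)) (reg.β k))) / (∫ U : GaugeConfig 4 (2 * S + 1) (Matrix.specialUnitaryGroup (Fin 3) ℂ), (‖(diracMatrix U fun fl => reg.mcrit k + reg.a k * m fl / reg.Zm k).det‖ : ℂ) ∂(wilsonMeasure (fundamentalRep (Fin 3)) (reg.β k)))‖ ≤ C' * Real.exp (-(δ' * (reg.a k * n))))) →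
        ∀ (m : Fin Nf → ℝ), (∀ f, 0 < m f) → ∀ (z shift : QCDField Nf → ℕ → ℝ) (φ : ℕ → ℕ), StrictMono φ →
        (∃ T : OSData (QCDField Nf) 4, ∀ (n : ℕ), n ≠ 0 → ∀ (σ : Fin n → QCDField Nf) (f : Fin n → 𝓢(EuclideanSpace ℝ (Fin 4), ℝ))
            (F : 𝓢((Fin n → EuclideanSpace ℝ (Fin 4)), ℂ)), IsTensorOf F (fun i => ofRealTest (f i)) → IsOffDiagonal F →
            Tendsto (fun k : ℕ => qcdPhaseQuenchedExpect ((reg.scheme m z shift).β (φ k)) ((reg.scheme m z shift).side (φ k)) (fun fl => (reg.scheme m z shift).mq fl (φ k)) (fun U => (fermiIntegral ((List.ofFn fun i => smearedInsertion (reg.scheme m z shift) (φ k) U (σ i) (f i)).prod * fermiBoltzmann U fun fl => (reg.scheme m z shift).mq fl (φ k)) / fermiIntegral (fermiBoltzmann U fun fl => (reg.scheme m z shift).mq fl (φ k))))) atTop (𝓝 (T.schwinger n σ F))) →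
        ∀ (n : ℕ), n ≠ 0 → ∀ (σ : Fin n → QCDField Nf) (f : Fin n → 𝓢(EuclideanSpace ℝ (Fin 4), ℝ))
          (F : 𝓢((Fin n → EuclideanSpace ℝ (Fin 4)), ℂ)), IsTensorOf F (fun i => ofRealTest (f i)) → IsOffDiagonal F →
          Tendsto (fun k : ℕ =>
            (qcdPhaseQuenchedExpect ((reg.scheme m z shift).β (φ k)) ((reg.scheme m z shift).side (φ k)) (fun fl => (reg.scheme m z shift).mq fl (φ k)) (fun U => qcdDetPhase U (fun fl => (reg.scheme m z shift).mq fl (φ k)) * (fermiIntegral ((List.ofFn fun i => smearedInsertion (reg.scheme m z shift) (φ k) U (σ i) (f i)).prod * fermiBoltzmann U fun fl => (reg.scheme m z shift).mq fl (φ k)) / fermiIntegral (fermiBoltzmann U fun fl => (reg.scheme m z shift).mq fl (φ k)))) -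
              qcdPhaseQuenchedExpect ((reg.scheme m z shift).β (φ k)) ((reg.scheme m z shift).side (φ k)) (fun fl => (reg.scheme m z shift).mq fl (φ k)) (fun U => qcdDetPhase U (fun fl => (reg.scheme m z shift).mq fl (φ k))) *
                qcdPhaseQuenchedExpect ((reg.scheme m z shift).β (φ k)) ((reg.scheme m z shift).side (φ k)) (fun fl => (reg.scheme m z shift).mq fl (φ k)) (fun U => (fermiIntegral ((List.ofFn fun i => smearedInsertion (reg.scheme m z shift) (φ k) U (σ i) (f i)).prod * fermiBoltzmann U fun fl => (reg.scheme m z shift).mq fl (φ k)) / fermiIntegral (fermiBoltzmann U fun fl => (reg.scheme m z shift).mq fl (φ k)))))) atTop (𝓝 0))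
    (h₃ : ∀ (Nf : ℕ), Nf = 2 ∨ Nf = 3 → ∀ (reg : QCDRegularisation Nf),
        (reg.HasMassScaling ∧ (reg.scheme 0 0 0).HasAsymptoticScaling ∧
          ∀ m : Fin Nf → ℝ, (∀ f, 0 < m f) →
            ((∀ f : Fin Nf, ∀ᶠ k in atTop, -1 < reg.mcrit k + reg.a k * m f / reg.Zm k) ∧
              (∃ s δ C : ℝ, 0 < s ∧ s < 1 ∧ 0 < δ ∧ ∀ᶠ k in atTop, ∀ S : ℕ, reg.L k ≤ S → ∀ (f : Fin Nf) (v : Literature.Probability.LatticeModels.Site 4), v ∈ box 4 S → (∫ U : GaugeConfig 4 (2 * S + 1) (Matrix.specialUnitaryGroup (Fin 3) ℂ), ‖(diracMatrix U fun fl => reg.mcrit k + reg.a k * m fl / reg.Zm k).det‖ * (∑ a : Fin 3, ∑ i : Fin 4, ∑ b : Fin 3, ∑ j : Fin 4, ‖(diracMatrix U fun fl => reg.mcrit k + reg.a k * m fl / reg.Zm k)⁻¹ (quarkEquiv (f, (Torus.proj (2 * S + 1) 0, a, i))) (quarkEquiv (f, (Torus.proj (2 * S + 1) (v), b, j)))‖)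 ^ s ∂(wilsonMeasure (fundamentalRep (Fin 3)) (reg.β k))) / (∫ U : GaugeConfig 4 (2 * S + 1) (Matrix.specialUnitaryGroup (Fin 3) ℂ), ‖(diracMatrix U fun fl => reg.mcrit k + reg.a k * m fl / reg.Zm k).det‖ ∂(wilsonMeasure (fundamentalRep (Fin 3)) (reg.β k))) ≤ C * Real.exp (-(δ * (reg.a k * ‖v‖)))) ∧
              (∃ s c₀ C₁ p : ℝ, 0 < s ∧ s < 1 ∧ 0 < c₀ ∧ ∀ᶠ k in atTop, ∀ S : ℕ, reg.L k ≤ S → ∀ (f : Fin Nf) (n : ℕ), n ≤ S → c₀ * Real.exp (-(C₁ * (reg.a k * n) + p * Real.log (n + 1))) ≤ (∫ U : GaugeConfig 4 (2 * S + 1) (Matrix.specialUnitaryGroup (Fin 3) ℂ), ‖(diracMatrix U fun fl => reg.mcrit k + reg.a k * m fl / reg.Zm k).det‖ * (∑ a : Fin 3, ∑ i : Fin 4, ∑ b : Fin 3, ∑ j : Fin 4, ‖(diracMatrix U fun fl => reg.mcrit k + reg.a k * m fl / reg.Zm k)⁻¹ (quarkEquiv (f, (Torus.proj (2 * S + 1)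 0, a, i))) (quarkEquiv (f, (Torus.proj (2 * S + 1) (Pi.single 0 (n : ℤ)), b, j)))‖) ^ s ∂(wilsonMeasure (fundamentalRep (Fin 3)) (reg.β k))) / (∫ U : GaugeConfig 4 (2 * S + 1) (Matrix.specialUnitaryGroup (Fin 3) ℂ), ‖(diracMatrix U fun fl => reg.mcrit k + reg.a k * m fl / reg.Zm k).det‖ ∂(wilsonMeasure (fundamentalRep (Fin 3)) (reg.β k)))) ∧
              (∀ᶠ k in atTop, (1 / 2 : ℝ) ≤ ‖∫ U : GaugeConfig 4 (2 * reg.L k + 1) (Matrix.specialUnitaryGroup (Fin 3) ℂ), (diracMatrix U fun fl => reg.mcrit k + reg.a k * m fl / reg.Zm k).det ∂(wilsonMeasure (fundamentalRep (Fin 3)) (reg.β k))‖ / (∫ U : GaugeConfig 4 (2 * reg.L k + 1) (Matrix.specialUnitaryGroup (Fin 3) ℂ), ‖(diracMatrix U fun fl => reg.mcrit k + reg.a k * m fl / reg.Zm k).det‖ ∂(wilsonMeasure (fundamentalRep (Fin 3)) (reg.β k))))) ∧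
            (∃ δ' : ℝ, 0 < δ' ∧ ∀ (R R' : ℕ) (A : QCDLatticeObservable Nf R) (B : QCDLatticeObservable Nf R'), (∃ (f₀ : Fin Nf) (q : ℤ), q ≠ 0 ∧ ∀ (θ : ℝ) (U : LGConfig 4 (Matrix.specialUnitaryGroup (Fin 3) ℂ)), ExteriorAlgebra.map (LinearMap.pi fun w => (Sum.elim (fun i => if (boxQuarkEquiv.symm i).1 = f₀ then Complex.exp (-((θ : ℂ) * Complex.I)) else 1) (fun i => if (boxQuarkEquiv.symm i).1 = f₀ then Complex.exp ((θ : ℂ) * Complex.I) else 1) (ofLex w)) • LinearMap.proj w) (A.F U) = Complex.exp (((q : ℝ) * θ : ℝ) * Complex.I) • A.F U) → ∃ C' : ℝ, ∀ᶠ k in atTop, ∀ S : ℕ, reg.L k ≤ S → ∀ n : ℕ, n ≤ S → ‖(∫ U : GaugeConfig 4 (2 * S + 1) (Matrix.specialUnitaryGroup (Fin 3) ℂ), (‖(diracMatrix U fun fl => reg.mcrit k + reg.a k * m fl / reg.Zm k).det‖ : ℂ) * (fermiIntegral (A.onTorus (2 * S + 1) 0 U * B.onTorus (2 * S + 1) (Pi.single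 0 (n : ℤ)) U * fermiBoltzmann U fun fl => reg.mcrit k + reg.a k * m fl / reg.Zm k) / fermiIntegral (fermiBoltzmann U fun fl => reg.mcrit k + reg.a k * m fl / reg.Zm k)) ∂(wilsonMeasure (fundamentalRep (Fin 3)) (reg.β k))) / (∫ U : GaugeConfig 4 (2 * S + 1) (Matrix.specialUnitaryGroup (Fin 3) ℂ), (‖(diracMatrix U fun fl => reg.mcrit k + reg.a k * m fl / reg.Zm k).det‖ : ℂ) ∂(wilsonMeasure (fundamentalRep (Fin 3)) (reg.β k)))‖ ≤ C' * Real.exp (-(δ' * (reg.a k * n))))) →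
        ∃ φ : ℕ → ℕ, StrictMono φ ∧ ∀ (m : Fin Nf → ℝ), (∀ f, 0 < m f) →
          ∃ (z shift : QCDField Nf → ℕ → ℝ) (T : OSData (QCDField Nf) 4),
            (∀ (n : ℕ), n ≠ 0 → ∀ (σ : Fin n → QCDField Nf) (f : Fin n → 𝓢(EuclideanSpace ℝ (Fin 4), ℝ))
              (F : 𝓢((Fin n → EuclideanSpace ℝ (Fin 4)), ℂ)), IsTensorOf F (fun i => ofRealTest (f i)) → IsOffDiagonal F →
              Tendsto (fun k : ℕ => qcdPhaseQuenchedExpect ((reg.scheme m z shift).β (φ k)) ((reg.scheme m z shift).side (φ k)) (fun fl => (reg.scheme m z shift).mq fl (φ k)) (fun U => (fermiIntegral ((List.ofFn fun i => smearedInsertion (reg.scheme m z shift) (φ k) U (σ i) (f i)).prod * fermiBoltzmann U fun fl => (reg.scheme m z shift).mq fl (φ k)) / fermiIntegral (fermiBoltzmann U fun fl => (reg.scheme m z shift).mq fl (φ k))))) atTop (𝓝 (T.schwinger n σ F))) ∧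
            T.IsNontrivial QCDField.glue ∧ T.IsNonGaussian QCDField.glue ∧
            (∀ f g : Fin Nf, f ≠ g → T.IsNontrivial (QCDField.pseudoRe f g)) ∧
            ∃ Δ > 0, T.HasMassGap Δ)
    (h₄ : ∀ (Nf : ℕ), Nf = 2 ∨ Nf = 3 → ∀ (reg : QCDRegularisation Nf),
        (reg.HasMassScaling ∧ (reg.scheme 0 0 0).HasAsymptoticScaling ∧
          ∀ m : Fin Nf → ℝ, (∀ f, 0 < m f) →
            ((∀ f : Fin Nf, ∀ᶠ k in atTop, -1 < reg.mcrit k + reg.a k * m f / reg.Zm k) ∧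
              (∃ s δ C : ℝ, 0 < s ∧ s < 1 ∧ 0 < δ ∧ ∀ᶠ k in atTop, ∀ S : ℕ, reg.L k ≤ S → ∀ (f : Fin Nf) (v : Literature.Probability.LatticeModels.Site 4), v ∈ box 4 S → (∫ U : GaugeConfig 4 (2 * S + 1) (Matrix.specialUnitaryGroup (Fin 3) ℂ), ‖(diracMatrix U fun fl => reg.mcrit k + reg.a k * m fl / reg.Zm k).det‖ * (∑ a : Fin 3, ∑ i : Fin 4, ∑ b : Fin 3, ∑ j : Fin 4, ‖(diracMatrix U fun fl => reg.mcrit k + reg.a k * m fl / reg.Zm k)⁻¹ (quarkEquiv (f, (Torus.proj (2 * S + 1) 0, a, i))) (quarkEquiv (f, (Torus.proj (2 * S + 1) (v), b, j)))‖) ^ s ∂(wilsonMeasure (fundamentalRep (Fin 3)) (reg.β k))) / (∫ U : GaugeConfig 4 (2 * S + 1) (Matrix.specialUnitaryGroup (Fin 3) ℂ), ‖(diracMatrix U fun fl => reg.mcrit k + reg.a k * m fl / reg.Zm k).det‖ ∂(wilsonMeasure (fundamentalRep (Fin 3)) (reg.β k))) ≤ C * Real.exp (-(δ * (reg.a k *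 ‖v‖)))) ∧
              (∃ s c₀ C₁ p : ℝ, 0 < s ∧ s < 1 ∧ 0 < c₀ ∧ ∀ᶠ k in atTop, ∀ S : ℕ, reg.L k ≤ S → ∀ (f : Fin Nf) (n : ℕ), n ≤ S → c₀ * Real.exp (-(C₁ * (reg.a k * n) + p * Real.log (n + 1))) ≤ (∫ U : GaugeConfig 4 (2 * S + 1) (Matrix.specialUnitaryGroup (Fin 3) ℂ), ‖(diracMatrix U fun fl => reg.mcrit k + reg.a k * m fl / reg.Zm k).det‖ * (∑ a : Fin 3, ∑ i : Fin 4, ∑ b : Fin 3, ∑ j : Fin 4, ‖(diracMatrix U fun fl => reg.mcrit k + reg.a k * m fl / reg.Zm k)⁻¹ (quarkEquiv (f, (Torus.proj (2 * S + 1) 0, a, i))) (quarkEquiv (f, (Torus.proj (2 * S + 1) (Pi.single 0 (n : ℤ)), b, j)))‖) ^ s ∂(wilsonMeasure (fundamentalRep (Fin 3)) (reg.β k))) / (∫ U : GaugeConfig 4 (2 * S + 1) (Matrix.specialUnitaryGroup (Fin 3) ℂ), ‖(diracMatrix U fun fl => reg.mcrit k + reg.a k * m fl / reg.Zm k).det‖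 ∂(wilsonMeasure (fundamentalRep (Fin 3)) (reg.β k)))) ∧
              (∀ᶠ k in atTop, (1 / 2 : ℝ) ≤ ‖∫ U : GaugeConfig 4 (2 * reg.L k + 1) (Matrix.specialUnitaryGroup (Fin 3) ℂ), (diracMatrix U fun fl => reg.mcrit k + reg.a k * m fl / reg.Zm k).det ∂(wilsonMeasure (fundamentalRep (Fin 3)) (reg.β k))‖ / (∫ U : GaugeConfig 4 (2 * reg.L k + 1) (Matrix.specialUnitaryGroup (Fin 3) ℂ), ‖(diracMatrix U fun fl => reg.mcrit k + reg.a k * m fl / reg.Zm k).det‖ ∂(wilsonMeasure (fundamentalRep (Fin 3)) (reg.β k))))) ∧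
            (∃ δ' : ℝ, 0 < δ' ∧ ∀ (R R' : ℕ) (A : QCDLatticeObservable Nf R) (B : QCDLatticeObservable Nf R'), (∃ (f₀ : Fin Nf) (q : ℤ), q ≠ 0 ∧ ∀ (θ : ℝ) (U : LGConfig 4 (Matrix.specialUnitaryGroup (Fin 3) ℂ)), ExteriorAlgebra.map (LinearMap.pi fun w => (Sum.elim (fun i => if (boxQuarkEquiv.symm i).1 = f₀ then Complex.exp (-((θ : ℂ) * Complex.I)) else 1) (fun i => if (boxQuarkEquiv.symm i).1 = f₀ then Complex.exp ((θ : ℂ) * Complex.I) else 1) (ofLex w)) • LinearMap.proj w) (A.F U) = Complex.exp (((q : ℝ) * θ : ℝ) * Complex.I) • A.F U) → ∃ C' : ℝ, ∀ᶠ k in atTop, ∀ S : ℕ, reg.L k ≤ S → ∀ n : ℕ, n ≤ S → ‖(∫ U : GaugeConfig 4 (2 * S + 1) (Matrix.specialUnitaryGroup (Fin 3) ℂ), (‖(diracMatrix U fun fl => reg.mcrit k + reg.a k * m fl / reg.Zm k).det‖ : ℂ) * (fermiIntegral (A.onTorus (2 * S + 1) 0 U * B.onTorus (2 * S + 1) (Pi.single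 0 (n : ℤ)) U * fermiBoltzmann U fun fl => reg.mcrit k + reg.a k * m fl / reg.Zm k) / fermiIntegral (fermiBoltzmann U fun fl => reg.mcrit k + reg.a k * m fl / reg.Zm k)) ∂(wilsonMeasure (fundamentalRep (Fin 3)) (reg.β k))) / (∫ U : GaugeConfig 4 (2 * S + 1) (Matrix.specialUnitaryGroup (Fin 3) ℂ), (‖(diracMatrix U fun fl => reg.mcrit k + reg.a k * m fl / reg.Zm k).det‖ : ℂ) ∂(wilsonMeasure (fundamentalRep (Fin 3)) (reg.β k)))‖ ≤ C' * Real.exp (-(δ' * (reg.a k * n))))) →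
        ∀ (m : Fin Nf → ℝ), (∀ f, 0 < m f) →
          ∃ Δ > 0, ∀ (z shift : QCDField Nf → ℕ → ℝ), (reg.scheme m z shift).HasLatticeMassGap Δ) :
    Summit.QuantumFields.QCD.Theses.PauliWegnerSea.GluonicCompletion := by
  intro Nf hNf hH
  obtain ⟨reg, hbody⟩ := hH
  obtain ⟨φ, hφ, hT⟩ := h₃ Nf hNf reg hbody
  obtain ⟨hMS, hAS, hPM⟩ := hbody
  refine ⟨regSubseq reg φ hφ, hasMassScaling_subseq hMS φ hφ, fun m hm => ?_⟩
  obtain ⟨z, shift, T, hconv, hN, hG, hP, Δ₁, hΔ₁, hgap₁⟩ := hT m hm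
  obtain ⟨⟨hi, hii, hiii, hiv⟩, hpqfd⟩ := hPM m hm
  obtain ⟨Δ₂, hΔ₂, hgap₂⟩ := h₄ Nf hNf reg ⟨hMS, hAS, hPM⟩ m hm
  have hcov := h₂ Nf hNf reg ⟨hMS, hAS, hPM⟩ m hm z shift φ hφ ⟨T, hconv⟩
  refine ⟨fun s k => z s (φ k), fun s k => shift s (φ k), T, ?_, hN, hG, hP,
    min Δ₁ Δ₂, lt_min hΔ₁ hΔ₂, hasMassGap_anti hgap₁ (min_le_left _ _), ?_⟩
  · -- `IsQCDAlong` along the subsequence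
    rw [regSubseq_scheme]
    refine ⟨hasAsymptoticScaling_subseq hAS φ hφ, fun fl => hφ.tendsto_atTop.eventually (hi fl), ?_⟩
    intro n hn σ f F hF hoff
    have hpq := hconv n hn σ f F hF hoff
    have hc := hcov n hn σ f F hF hoff
    -- clause (iv), transported along `φ`, in the scheme's own vocabulary
    have hiv' : ∀ᶠ k in atTop, (1 / 2 : ℝ) ≤
        ‖∫ U, (diracMatrix U fun fl => (reg.scheme m z shift).mq fl (φ k)).det
            ∂(wilsonMeasure (d := 4) (L := (reg.scheme m z shift).side (φ k)) (fundamentalRep (Fin 3)) ((reg.scheme m z shift).β (φ k)))‖ /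
          ∫ U, ‖(diracMatrix U fun fl => (reg.scheme m z shift).mq fl (φ k)).det‖
            ∂(wilsonMeasure (d := 4) (L := (reg.scheme m z shift).side (φ k)) (fundamentalRep (Fin 3)) ((reg.scheme m z shift).β (φ k))) :=
      hφ.tendsto_atTop.eventually hiv
    -- the sign budget: ‖honest − PQ‖ ≤ 2 ‖Cov‖ eventually
    have hbound : ∀ᶠ k in atTop,
        ‖qcdLatticeSchwinger (reg.scheme m z shift) (φ k) n σ f - qcdPhaseQuenchedExpect ((reg.scheme m z shift).β (φ k)) ((reg.scheme m z shift).side (φ k)) (fun fl => (reg.scheme m z shift).mq fl (φ k)) (fun U => (fermiIntegral ((List.ofFn fun i => smearedInsertion (reg.scheme m z shift) (φ k) U (σ i) (f i)).prod * fermiBoltzmann U fun fl => (reg.scheme m z shift).mq fl (φ k)) / fermiIntegral (fermiBoltzmann U fun fl => (reg.scheme m z shift).mq fl (φ k))))‖ ≤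
          2 * ‖(qcdPhaseQuenchedExpect ((reg.scheme m z shift).β (φ k)) ((reg.scheme m z shift).side (φ k)) (fun fl => (reg.scheme m z shift).mq fl (φ k)) (fun U => qcdDetPhase U (fun fl => (reg.scheme m z shift).mq fl (φ k)) * (fermiIntegral ((List.ofFn fun i => smearedInsertion (reg.scheme m z shift) (φ k) U (σ i) (f i)).prod * fermiBoltzmann U fun fl => (reg.scheme m z shift).mq fl (φ k)) / fermiIntegral (fermiBoltzmann U fun fl => (reg.scheme m z shift).mq fl (φ k)))) -
            qcdPhaseQuenchedExpect ((reg.scheme m z shift).β (φ k)) ((reg.scheme m z shift).side (φ k)) (fun fl => (reg.scheme m z shift).mq fl (φ k)) (fun U => qcdDetPhase U (fun fl => (reg.scheme m z shift).mq fl (φ k))) *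
              qcdPhaseQuenchedExpect ((reg.scheme m z shift).β (φ k)) ((reg.scheme m z shift).side (φ k)) (fun fl => (reg.scheme m z shift).mq fl (φ k)) (fun U => (fermiIntegral ((List.ofFn fun i => smearedInsertion (reg.scheme m z shift) (φ k) U (σ i) (f i)).prod * fermiBoltzmann U fun fl => (reg.scheme m z shift).mq fl (φ k)) / fermiIntegral (fermiBoltzmann U fun fl => (reg.scheme m z shift).mq fl (φ k)))))‖ := by
      filter_upwards [hiv'] with k hk
      rw [qcdLatticeSchwinger_eq_qcdTorusExpect]
      exact norm_qcdTorusExpect_sub_phaseQuenched_le _ _ _ hk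
        (h₁ Nf _ _ _ (exists_det_ne_zero_of_half_le_ratio _ _ hk))
    have hdiff : Tendsto (fun k : ℕ => qcdLatticeSchwinger (reg.scheme m z shift) (φ k) n σ f - qcdPhaseQuenchedExpect ((reg.scheme m z shift).β (φ k)) ((reg.scheme m z shift).side (φ k)) (fun fl => (reg.scheme m z shift).mq fl (φ k)) (fun U => (fermiIntegral ((List.ofFn fun i => smearedInsertion (reg.scheme m z shift) (φ k) U (σ i) (f i)).prod * fermiBoltzmann U fun fl => (reg.scheme m z shift).mq fl (φ k)) / fermiIntegral (fermiBoltzmann U fun fl => (reg.scheme m z shift).mq fl (φ k))))) atTop (𝓝 0) := by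
      refine squeeze_zero_norm' hbound ?_
      have h2 := (hc.norm).const_mul (2 : ℝ)
      rw [norm_zero, mul_zero] at h2
      exact h2
    have hsum := hpq.add hdiff
    rw [add_zero] at hsum
    refine hsum.congr fun k => ?_
    rw [add_sub_cancel, qcdLatticeSchwinger_subseq]
  · -- the lattice gap along the subsequence
    rw [regSubseq_scheme]
    exact hasLatticeMassGap_subseq (hasLatticeMassGap_anti (hgap₂ z shift) (min_le_right _ _)) φ hφ

/-- The composition instantiated with the four stubs (so it depends on their `sorry`s and on nothing
else): the stub statements ARE, syntactically, the hypotheses of `GluonicCompletion_of`. -/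
theorem GluonicCompletion_of_stubs : Summit.QuantumFields.QCD.Theses.PauliWegnerSea.GluonicCompletion :=
  GluonicCompletion_of detNonvanishing stub_signDecorrelation stub_pqContinuum stub_signedLatticeGap

/-- The two route copies of the crux are the same proposition (cf. Disproof `eq_wilsonMobilityGap`). -/
theorem gluonicCompletion_eq_wilsonMobilityGap :
    Summit.QuantumFields.QCD.Theses.PauliWegnerSea.GluonicCompletion =
      Summit.QuantumFields.QCD.Theses.WilsonMobilityGap.GluonicCompletion := rfl

/-- … so the same skeleton closes the sibling route's copy (route-QuantumFields-WilsonMobilityGap, rank 4). -/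
theorem WilsonMobilityGap_GluonicCompletion_of_stubs :
    Summit.QuantumFields.QCD.Theses.WilsonMobilityGap.GluonicCompletion :=
  GluonicCompletion_of_stubs

end Summit.QuantumFields.QCD.Cruxes.GluonicCompletion.FiniteSignBudgetAtTheSchemeVolume

end
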